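import Literature.MathematicalPhysics.QuantumFieldTheory.Balaban1983to89.DagBinding
import HarnessLib

/-!
# Crux `UVSeamRec` (stmt-QuantumFields-20043), stub `stub_ceilings`: the FLOW HALF of E0′, part 1 —
# a ONE-SIDED two-loop bound on the β-functions keeps every weak run of Bałaban's construction in `]0, γ]`
# along a window of two-loop length

Helper file (`--supports stmt-QuantumFields-20043`) of the lead prover (unit `ym-spine-20043-p1`, gen 5).  Part 2
(`BalabanLadderUVSeamRecFlowWindowUnit`) reads the window in the two-loop unit of record `uRec` and at a finite-ε datum;
its module docstring carries the located discussion (what `stub_ceilings` must consume on the flow side, why (0.31) ∕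
one-loop bounds do not suffice, conventions `κ`, `a = 4κb₀ log L`, `b = 8κ²b₁ log L`).

THE INPUT (hypothesis shape, never asserted; unprinted for Bałaban's scheme): the history family `β : FlowStep.HBeta`
that forward-generates the construction (`DagBinding.ForwardGenerated`, [Balaban1987RG1] (0.17)–(0.20):
`1/g_{k+1}² = 1/g_k² − β_k(g_0,…,g_k)`) obeys on the boxes `]0, γ₀]^{k+1}` the ONE-SIDED two-loop upper bound
    `β_k(g_0, …, g_k) ≤ a + δ_k + b·g_k² + C·g_k⁴`
(`a > 0`, `b, C ≥ 0`, `δ_k ≥ 0` with partial sums `≤ Δ` — a summable scale-dependent excess, which absorbs k-dependent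
one- and two-loop coefficients converging to `a`, `b` from above at a summable rate since `g_k² ≤ γ₀²` on the box).
NOT needed: a lower bound, a sign, convergence of the β-functions, tuning, endpoint existence, `(B)`.

WHAT THIS FILE PROVES (0 sorry, axioms standard; elementary real analysis + the tree's flow bookkeeping):
§1 `sum_inv_affine_le_log`, `sum_inv_sq_affine_le` — `Σ_{j<k} 1/(A − a j) ≤ (1/a) log(A/(A − a k))`,
   `Σ_{j<k} 1/(A − a j)² ≤ (1/a)(1/(A − a k) − 1/A)` (`a > 0`, `A − a k > 0`).
§2 `window_induction` — the discrete comparison: a sequence with `x_{k+1} ≥ x_k − (a + δ_k + b/x_k + C/x_k²)` (while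
   its earlier terms are above the floor `X`) stays above the line `x₀ − Φ − a·k` along the whole window
   `a·k ≤ x₀ − X − Φ`, the budget `Φ = Δ + (b/a) log(x₀/X) + b/X + C/X² + C/(aX)` being paid ONCE — so the window
   is `x₀/a − (b/a²) log x₀ − O(1)` steps long (two-loop accuracy up to O(1)).
§3 `inInterval_of_twoLoopUpper` — for `C : B12.Construction` forward-generated by `β` obeying the input: some
   `γ ∈ ]0, γ₀]` such that EVERY run `⟨K, m, g₀⟩` with `0 < g₀ ≤ γ` and `a·K ≤ 1/g₀² − 1/γ² − Φ(1/g₀²)` satisfies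
   `Setup.Flow.InInterval γ K` — the standing hypothesis of [Balaban1989LargeFieldII] Thm 1 (`B16.Thm1Printed`) for that
   run; coupling COVERAGE: every weak bare coupling, not only tuned sequences.
HONEST FRAMING: conditional bookkeeping for an OPEN hypothesis of a conditional chain (`BalabanLadder.closes`, 0∕6 legs
discharged); nothing of Bałaban's programme is asserted; not a mass gap, not Clay.
-/

set_option autoImplicit false

namespace Summit.QuantumFields.YangMills.Cruxes.UVSeamRec.FlowWindow

open Real Filter Topology Finset
open Literature.MathematicalPhysics.QuantumFieldTheory.Balaban1983to89

noncomputable section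

/-! ## §1 Two summation lemmas along an arithmetic progression -/

/-- `∑_{j<k} 1/(A − a j) ≤ (1/a)·log(A/(A − a k))` for `a > 0` and `A − a k > 0` (integral comparison, via
`1 − u⁻¹ ≤ log u`). [folklore] -/
theorem sum_inv_affine_le_log {A a : ℝ} (ha : 0 < a) :
    ∀ k : ℕ, 0 < A - a * k → ∑ j ∈ range k, 1 / (A - a * j) ≤ 1 / a * Real.log (A / (A - a * k))
  | 0, _ => by simp
  | k + 1, hk => by
    have hk' : 0 < A - a * k := by
      have : (k : ℝ) ≤ (k + 1 : ℕ) := by exact_mod_cast Nat.le_succ k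
      nlinarith
    have ih := sum_inv_affine_le_log ha k hk'
    rw [sum_range_succ]
    -- the new term is paid by the log increment
    have hu : 0 < (A - a * k) / (A - a * (k + 1 : ℕ)) := div_pos hk' hk
    have hlog := Real.one_sub_inv_le_log_of_pos hu
    rw [inv_div] at hlog
    have hstep : 1 / (A - a * k) ≤ 1 / a * Real.log ((A - a * k) / (A - a * (k + 1 : ℕ))) := by
      have h1 : 1 - (A - a * (k + 1 : ℕ)) / (A - a * k) = a * (1 / (A - a * k)) := by
        field_simp
        push_cast
        ring
      rw [h1] at hlog
      calc 1 / (A - a * k) = 1 / a * (a * (1 / (A - a * k))) := by field_simp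
        _ ≤ 1 / a * Real.log ((A - a * k) / (A - a * (k + 1 : ℕ))) :=
          mul_le_mul_of_nonneg_left hlog (by positivity)
    have hsplit : Real.log (A / (A - a * (k + 1 : ℕ))) =
        Real.log (A / (A - a * k)) + Real.log ((A - a * k) / (A - a * (k + 1 : ℕ))) := by
      have hA : 0 < A := by
        have : (0 : ℝ) ≤ a * k := by positivity
        linarith
      rw [← Real.log_mul (div_pos hA hk').ne' hu.ne']
      congr 1
      field_simp
    rw [hsplit, mul_add]
    exact add_le_add ih hstep

/-- `∑_{j<k} 1/(A − a j)² ≤ (1/a)·(1/(A − a k) − 1/A)` for `a > 0` and `A − a k > 0` (telescoping). [folklore] -/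
theorem sum_inv_sq_affine_le {A a : ℝ} (ha : 0 < a) :
    ∀ k : ℕ, 0 < A - a * k → ∑ j ∈ range k, 1 / (A - a * j) ^ 2 ≤ 1 / a * (1 / (A - a * k) - 1 / A)
  | 0, _ => by simp
  | k + 1, hk => by
    have hk' : 0 < A - a * k := by
      have : (k : ℝ) ≤ (k + 1 : ℕ) := by exact_mod_cast Nat.le_succ k
      nlinarith
    have ih := sum_inv_sq_affine_le ha k hk'
    rw [sum_range_succ]
    have hstep : 1 / (A - a * k) ^ 2 ≤ 1 / a * (1 / (A - a * (k + 1 : ℕ)) - 1 / (A - a * k)) := by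
      have h1 : 1 / a * (1 / (A - a * (k + 1 : ℕ)) - 1 / (A - a * k)) =
          1 / ((A - a * k) * (A - a * (k + 1 : ℕ))) := by
        field_simp
        push_cast
        ring
      rw [h1, one_div_le_one_div (by positivity) (mul_pos hk' hk), sq]
      have hle : A - a * (k + 1 : ℕ) ≤ A - a * k := by
        have : (k : ℝ) ≤ (k + 1 : ℕ) := by exact_mod_cast Nat.le_succ k
        nlinarith
      exact mul_le_mul_of_nonneg_left hle hk'.le
    calc ∑ j ∈ range k, 1 / (A - a * j) ^ 2 + 1 / (A - a * k) ^ 2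
        ≤ 1 / a * (1 / (A - a * k) - 1 / A) + 1 / a * (1 / (A - a * (k + 1 : ℕ)) - 1 / (A - a * k)) :=
          add_le_add ih hstep
      _ = 1 / a * (1 / (A - a * (k + 1 : ℕ)) - 1 / A) := by ring


/-! ## §2 The discrete two-loop comparison: window of a sequence with bounded-above decrements

Data: `a > 0` (one-loop decrement), `b, C ≥ 0` (two-loop and remainder sizes), a floor `X > 0`, a start `x₀ ≥ X`.
A non-negative scale-dependent excess `δ k` with partial sums `≤ Δ` (k-dependent coefficients converging at a
summable rate).  A sequence `x` with `x 0 = x₀` whose steps satisfy `x (k+1) ≥ x k − (a + δ k + b/x k + C/(x k)²)`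
as long as the earlier terms stay above the floor `X` stays above the comparison line `y j := x₀ − Φ − a j` for
every `k` with `a k ≤ x₀ − X − Φ`, where `Φ = Δ + (b/a) log(x₀/X) + b/X + C/X² + C/(aX)` — the excess, the whole
two-loop log and the summable remainder are paid ONCE, so the window is `x₀/a − (b/a²) log x₀ − O(1)` steps long. -/

/-- The budget `Φ(x₀) = Δ + (b/a)·log(x₀/X) + b/X + C/X² + C/(aX)` paid by the scale-dependent excess, the two-loop
term and the remainder along the whole window is non-negative when `x₀ ≥ X > 0`. [folklore] -/
theorem budget_nonneg {a b C X x₀ Δ : ℝ} (ha : 0 < a) (hb : 0 ≤ b) (hC : 0 ≤ C) (hX : 0 < X) (hx₀ : X ≤ x₀)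
    (hΔ : 0 ≤ Δ) : 0 ≤ Δ + b / a * Real.log (x₀ / X) + (b / X + C / X ^ 2 + C / (a * X)) := by
  have hlog : 0 ≤ Real.log (x₀ / X) := Real.log_nonneg ((one_le_div hX).2 hx₀)
  positivity

/-- **The window lemma (abstract form).**  Let `Good : ℕ → Prop` be any side condition (for the flow: positivity
of the coupling) with `Good 0`, and let `x : ℕ → ℝ`, `x 0 = x₀ ≥ X > 0`.  Suppose that for every `k < K`, IF all
earlier terms are good and at least the floor `X` (`j ≤ k`), THEN `x (k+1)` is good and
`x (k+1) ≥ x k − (a + δ k + b/x k + C/(x k)²)`.  Then for every `k ≤ K` inside the window `a k ≤ x₀ − X − Φ` all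
terms `x j`, `j ≤ k`, are good and above the line (in particular `≥ X`). [folklore] -/
theorem window_induction {a b C X x₀ Δ : ℝ} (ha : 0 < a) (hb : 0 ≤ b) (hC : 0 ≤ C) (hX : 0 < X) (hx₀ : X ≤ x₀)
    (hΔ : 0 ≤ Δ) (δ : ℕ → ℝ) (hδ : ∀ n, ∑ k ∈ range n, δ k ≤ Δ)
    (Good : ℕ → Prop) (x : ℕ → ℝ) (K : ℕ) (hg0 : Good 0) (hx0 : x 0 = x₀)
    (hstep : ∀ k, k < K → (∀ j, j ≤ k → Good j ∧ X ≤ x j) →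
        Good (k + 1) ∧ x k - (a + δ k + b / x k + C / x k ^ 2) ≤ x (k + 1)) :
    ∀ k, k ≤ K → a * k ≤ x₀ - X - (Δ + b / a * Real.log (x₀ / X) + (b / X + C / X ^ 2 + C / (a * X))) →
      ∀ j, j ≤ k → Good j ∧
        x₀ - (Δ + b / a * Real.log (x₀ / X) + (b / X + C / X ^ 2 + C / (a * X))) - a * j ≤ x j := by
  set Φ := Δ + b / a * Real.log (x₀ / X) + (b / X + C / X ^ 2 + C / (a * X)) with hΦ
  have hΦ0 : 0 ≤ Φ := budget_nonneg ha hb hC hX hx₀ hΔ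
  -- the partial sums of the excess + two-loop + remainder decrements
  set S : ℕ → ℝ := fun k => ∑ j ∈ range k, (δ j + b / x j + C / x j ^ 2) with hS
  -- invariant: good, telescoped lower bound, and above the line
  suffices H : ∀ k, k ≤ K → a * k ≤ x₀ - X - Φ →
      ∀ j, j ≤ k → Good j ∧ x₀ - a * j - S j ≤ x j ∧ x₀ - Φ - a * j ≤ x j by
    intro k hk hwin j hj
    obtain ⟨hg, -, hl⟩ := H k hk hwin j hj
    exact ⟨hg, by linarith⟩
  intro k
  induction k with
  | zero =>
    intro _ _ j hj
    obtain rfl : j = 0 := Nat.le_zero.1 hj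
    refine ⟨hg0, ?_, ?_⟩
    · simp [hS, hx0]
    · simp [hx0]; linarith
  | succ k ih =>
    intro hk1 hwin1 j hj
    have hkK : k < K := Nat.lt_of_succ_le hk1
    have hwin : a * k ≤ x₀ - X - Φ := by
      have : (k : ℝ) ≤ (k + 1 : ℕ) := by exact_mod_cast Nat.le_succ k
      nlinarith
    have IH := ih hkK.le hwin
    rcases Nat.lt_or_ge j (k + 1) with hjk | hjk
    · exact IH j (Nat.lt_succ_iff.1 hjk)
    obtain rfl : j = k + 1 := le_antisymm hj hjk
    -- comparison line at `k` is above `X + a`, at `k+1` above `X`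
    have hyk : X + a ≤ x₀ - Φ - a * k := by push_cast at hwin1; linarith
    have hA : 0 < x₀ - Φ - a * k := by linarith
    -- every earlier term is ≥ its line value, which is ≥ the line value at k
    have hline : ∀ i, i ≤ k → x₀ - Φ - a * i ≤ x i := fun i hi => (IH i hi).2.2
    have hmono : ∀ i, i ≤ k → x₀ - Φ - a * k ≤ x₀ - Φ - a * i := fun i hi => by
      have : (i : ℝ) ≤ k := by exact_mod_cast hi
      nlinarith
    have hxpos : ∀ i, i ≤ k → 0 < x i := fun i hi => by linarith [hline i hi, hmono i hi]
    -- the step hypothesis applies at `k`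
    obtain ⟨hgood, hxk1⟩ := hstep k hkK fun j hj => ⟨(IH j hj).1, by linarith [hline j hj, hmono j hj]⟩
    -- (1) telescoped lower bound at k+1
    have hT : x₀ - a * (k + 1 : ℕ) - S (k + 1) ≤ x (k + 1) := by
      have hTk := (IH k le_rfl).2.1
      have hSk : S (k + 1) = S k + (δ k + b / x k + C / x k ^ 2) := by simp [hS, sum_range_succ]
      rw [hSk]; push_cast; linarith
    -- (2) the partial sum is within the budget
    have hSle : S (k + 1) ≤ Φ := by
      -- compare with the arithmetic progression A − a i, A = x₀ − Φ
      have hb_i : ∀ i, i ≤ k → b / x i ≤ b / (x₀ - Φ - a * i) := fun i hi =>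
        div_le_div_of_nonneg_left hb (by linarith [hmono i hi]) (hline i hi)
      have hC_i : ∀ i, i ≤ k → C / x i ^ 2 ≤ C / (x₀ - Φ - a * i) ^ 2 := fun i hi =>
        div_le_div_of_nonneg_left hC (pow_pos (by linarith [hmono i hi]) 2)
          (pow_le_pow_left₀ (by linarith [hmono i hi]) (hline i hi) 2)
      have hsum_b : ∑ i ∈ range k, b / x i ≤ b / a * Real.log ((x₀ - Φ) / (x₀ - Φ - a * k)) := by
        calc ∑ i ∈ range k, b / x i ≤ ∑ i ∈ range k, b / (x₀ - Φ - a * i) :=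
              sum_le_sum fun i hi => hb_i i (mem_range.1 hi).le
          _ = b * ∑ i ∈ range k, 1 / (x₀ - Φ - a * i) := by
              rw [mul_sum]; exact sum_congr rfl fun i _ => (mul_one_div b _).symm
          _ ≤ b * (1 / a * Real.log ((x₀ - Φ) / (x₀ - Φ - a * k))) :=
              mul_le_mul_of_nonneg_left (sum_inv_affine_le_log ha k hA) hb
          _ = b / a * Real.log ((x₀ - Φ) / (x₀ - Φ - a * k)) := by ring
      have hsum_C : ∑ i ∈ range k, C / x i ^ 2 ≤ C / a * (1 / (x₀ - Φ - a * k) - 1 / (x₀ - Φ)) := by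
        calc ∑ i ∈ range k, C / x i ^ 2 ≤ ∑ i ∈ range k, C / (x₀ - Φ - a * i) ^ 2 :=
              sum_le_sum fun i hi => hC_i i (mem_range.1 hi).le
          _ = C * ∑ i ∈ range k, 1 / (x₀ - Φ - a * i) ^ 2 := by
              rw [mul_sum]; exact sum_congr rfl fun i _ => (mul_one_div C _).symm
          _ ≤ C * (1 / a * (1 / (x₀ - Φ - a * k) - 1 / (x₀ - Φ))) :=
              mul_le_mul_of_nonneg_left (sum_inv_sq_affine_le ha k hA) hC
          _ = C / a * (1 / (x₀ - Φ - a * k) - 1 / (x₀ - Φ)) := by ring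
      -- the log is at most log(x₀/X), the reciprocals at most 1/X
      have hx₀pos : 0 < x₀ := lt_of_lt_of_le hX hx₀
      have hA' : 0 < x₀ - Φ := by
        have : (0 : ℝ) ≤ a * k := by positivity
        linarith
      have hlog_le : Real.log ((x₀ - Φ) / (x₀ - Φ - a * k)) ≤ Real.log (x₀ / X) := by
        apply Real.log_le_log (div_pos hA' hA)
        rw [div_le_div_iff₀ hA hX]
        have : (0 : ℝ) ≤ a * k := by positivity
        nlinarith
      have hrec_k : 1 / (x₀ - Φ - a * k) ≤ 1 / X := one_div_le_one_div_of_le hX (by linarith)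
      have hrec_0 : 0 ≤ 1 / (x₀ - Φ) := by positivity
      have hlast_b : b / x k ≤ b / X := le_trans (hb_i k le_rfl) (div_le_div_of_nonneg_left hb hX (by linarith))
      have hlast_C : C / x k ^ 2 ≤ C / X ^ 2 := le_trans (hC_i k le_rfl)
        (div_le_div_of_nonneg_left hC (by positivity) (pow_le_pow_left₀ hX.le (by linarith) 2))
      have hSk1 : S (k + 1) = (∑ i ∈ range (k + 1), δ i) + ((∑ i ∈ range k, b / x i) +
          (∑ i ∈ range k, C / x i ^ 2) + (b / x k + C / x k ^ 2)) := by
        simp only [hS, sum_range_succ, sum_add_distrib]; ring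
      rw [hSk1]
      have hδsum : ∑ i ∈ range (k + 1), δ i ≤ Δ := hδ (k + 1)
      have hba : 0 ≤ b / a := div_nonneg hb ha.le
      have hCa : 0 ≤ C / a := div_nonneg hC ha.le
      calc (∑ i ∈ range (k + 1), δ i) + ((∑ i ∈ range k, b / x i) + (∑ i ∈ range k, C / x i ^ 2) +
            (b / x k + C / x k ^ 2))
          ≤ Δ + (b / a * Real.log (x₀ / X) + C / a * (1 / X) + (b / X + C / X ^ 2)) := by
            have h1 := mul_le_mul_of_nonneg_left hlog_le hba
            have h2 : C / a * (1 / (x₀ - Φ - a * k) - 1 / (x₀ - Φ)) ≤ C / a * (1 / X) :=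
              mul_le_mul_of_nonneg_left (by linarith) hCa
            linarith
        _ = Φ := by rw [hΦ]; ring
    refine ⟨hgood, hT, ?_⟩
    linarith


/-! ## §3 Bałaban's flow: a ONE-SIDED two-loop bound keeps every weak run inside `]0, γ]` along the window

The construction `C : B12.Construction` is forward-generated by a history family `β : FlowStep.HBeta`
([Balaban1987RG1] (0.17)–(0.20): `1/g_{k+1}² = 1/g_k² − β_k(g_0,…,g_k)`, tree `DagBinding.ForwardGenerated`).  The ONLY
analytic input is an UPPER bound of two-loop shape on the boxes `]0, γ₀]^{k+1}`:
`β_k(g_0,…,g_k) ≤ a + δ_k + b·g_k² + C·g_k⁴` with a summable scale-dependent excess `δ_k ≥ 0` (`Σ δ_k ≤ Δ`; it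
absorbs k-dependent one- and two-loop coefficients converging to `a`, `b` from above at a summable rate, since
`g_k² ≤ γ₀²` on the box) — no lower bound, no sign, no convergence statement, no tuning, no endpoint.  Conclusion:
every run from a bare coupling `g₀ ∈ ]0, γ]` stays in `]0, γ]` for every number of steps `K` inside the window
`a·K ≤ 1/g₀² − 1/γ² − Φ(1/g₀²)`. -/

/-- From `1/γ² ≤ 1/g²` with `0 < g`, `0 < γ`: `g ≤ γ`. [folklore] -/
theorem le_of_inv_sq_le {g γ : ℝ} (hg : 0 < g) (hγ : 0 < γ) (h : 1 / γ ^ 2 ≤ 1 / g ^ 2) : g ≤ γ := by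
  have h2 : g ^ 2 ≤ γ ^ 2 := (one_div_le_one_div (by positivity) (by positivity)).1 h
  exact (pow_le_pow_iff_left₀ hg.le hγ.le two_ne_zero).1 h2

/-- **The window of a weak run (flow level).**  If `C` is forward-generated by `β` and `β` obeys the one-sided
two-loop upper bound `β_k(v) ≤ a + δ_k + b·v_k² + C·v_k⁴` on the boxes `]0, γ₀]^{k+1}` (`a > 0`, `b, C ≥ 0`,
`δ_k ≥ 0` with partial sums `≤ Δ`), then for some `γ ∈ ]0, γ₀]`: every run `⟨K, m, g₀⟩` with `0 < g₀ ≤ γ` and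
`a·K ≤ 1/g₀² − 1/γ² − Φ(1/g₀²)` (`Φ = Δ + (b/a) log(γ²/g₀²) + bγ² + Cγ⁴ + Cγ²/a`, written with `X = 1/γ²`)
satisfies `InInterval γ K` — the standing hypothesis of [Balaban1989LargeFieldII] Thm 1 for that run. [folklore] -/
theorem inInterval_of_twoLoopUpper (C : B12.Construction) (β : FlowStep.HBeta)
    (hgen : DagBinding.ForwardGenerated C β) {a b Cr γ₀ Δ : ℝ} (ha : 0 < a) (hb : 0 ≤ b) (hCr : 0 ≤ Cr)
    (hγ₀ : 0 < γ₀) (hΔ : 0 ≤ Δ) (δ : ℕ → ℝ) (hδ0 : ∀ k, 0 ≤ δ k) (hδ : ∀ n, ∑ k ∈ range n, δ k ≤ Δ)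
    (h2L : ∀ (k : ℕ) (v : Fin (k + 1) → ℝ), v ∈ FlowStep.Box γ₀ k →
      β k v ≤ a + δ k + b * v (Fin.last k) ^ 2 + Cr * v (Fin.last k) ^ 4) :
    ∃ γ : ℝ, 0 < γ ∧ γ ≤ γ₀ ∧ ∀ (K m : ℕ) (g0 : ℝ), 0 < g0 → g0 ≤ γ →
      a * K ≤ 1 / g0 ^ 2 - 1 / γ ^ 2 - (Δ + b / a * Real.log ((1 / g0 ^ 2) / (1 / γ ^ 2)) +
        (b / (1 / γ ^ 2) + Cr / (1 / γ ^ 2) ^ 2 + Cr / (a * (1 / γ ^ 2)))) →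
        (C ⟨K, m, g0⟩).flow.InInterval γ K := by
  -- the largest possible decrement on the box, and a γ with 1/γ² above it
  set M : ℝ := a + Δ + b * γ₀ ^ 2 + Cr * γ₀ ^ 4 with hM
  have hMpos : 0 < M := by positivity
  set γ : ℝ := min γ₀ (1 / Real.sqrt (M + 1)) with hγdef
  have hγpos : 0 < γ := lt_min hγ₀ (by positivity)
  have hγle : γ ≤ γ₀ := min_le_left _ _
  have hXM : M + 1 ≤ 1 / γ ^ 2 := by
    have hγ2 : γ ≤ 1 / Real.sqrt (M + 1) := min_le_right _ _
    have hs : 0 < Real.sqrt (M + 1) := Real.sqrt_pos.2 (by linarith)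
    have hγsq : γ ^ 2 ≤ 1 / (M + 1) := by
      calc γ ^ 2 ≤ (1 / Real.sqrt (M + 1)) ^ 2 := pow_le_pow_left₀ hγpos.le hγ2 2
        _ = 1 / (M + 1) := by rw [div_pow, one_pow, Real.sq_sqrt (by linarith)]
    rw [le_one_div (by linarith) (by positivity)]
    calc 1 / (M + 1) = 1 / (M + 1) := rfl
      _ ≥ γ ^ 2 := hγsq
  refine ⟨γ, hγpos, hγle, fun K m g0 hg0 hg0γ hwin => ?_⟩
  set X : ℝ := 1 / γ ^ 2 with hX
  have hXpos : 0 < X := by positivity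
  set P : B12.RunParams := ⟨K, m, g0⟩
  set g : ℕ → ℝ := (C P).flow.g with hg
  have hx₀X : X ≤ 1 / g0 ^ 2 :=
    one_div_le_one_div_of_le (by positivity) (pow_le_pow_left₀ hg0.le hg0γ 2)
  -- the abstract window lemma with Good k := 0 < g k and x k := 1/(g k)²
  have H := window_induction ha hb hCr hXpos hx₀X hΔ δ hδ (fun k => 0 < g k) (fun k => 1 / g k ^ 2) K
    (by show 0 < g 0; rw [hg, hgen.1 P]; exact hg0) (by show 1 / g 0 ^ 2 = 1 / g0 ^ 2; rw [hg, hgen.1 P])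
    (by
      intro k hk hprev
      -- the prefix lies in the box ]0, γ]^{k+1} ⊆ ]0, γ₀]^{k+1}
      have hposk : ∀ i, i ≤ k → 0 < g i := fun i hi => (hprev i hi).1
      have hleγ : ∀ i, i ≤ k → g i ≤ γ := fun i hi => le_of_inv_sq_le (hposk i hi) hγpos (hprev i hi).2
      have hbox : FlowStep.prefixOf g k ∈ FlowStep.Box γ₀ k := by
        rw [FlowStep.mem_box]
        intro i
        have hi : (i : ℕ) ≤ k := Nat.lt_succ_iff.1 i.isLt
        exact ⟨hposk i hi, (hleγ i hi).trans hγle⟩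
      have hβle := h2L k _ hbox
      simp only [FlowStep.prefixOf_apply, Fin.val_last] at hβle
      -- the decrement is below M < 1/γ² ≤ 1/g_k²
      have hgk : 0 < g k := hposk k le_rfl
      have hgkγ₀ : g k ≤ γ₀ := (hleγ k le_rfl).trans hγle
      have hβM : β k (FlowStep.prefixOf g k) ≤ M := by
        have h2 : g k ^ 2 ≤ γ₀ ^ 2 := pow_le_pow_left₀ hgk.le hgkγ₀ 2
        have h4 : g k ^ 4 ≤ γ₀ ^ 4 := pow_le_pow_left₀ hgk.le hgkγ₀ 4
        have hδk : δ k ≤ Δ := by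
          have := hδ (k + 1); rw [sum_range_succ] at this
          have h0 : 0 ≤ ∑ i ∈ range k, δ i := sum_nonneg fun i _ => hδ0 i
          linarith
        rw [hM]; nlinarith
      have hden : 0 < 1 / g k ^ 2 - β k (FlowStep.prefixOf g k) := by
        have := (hprev k le_rfl).2; linarith
      obtain ⟨hpos1, heq⟩ := hgen.2 P k hk hposk hden
      refine ⟨hpos1, ?_⟩
      -- rewrite g_k² = 1/x_k, g_k⁴ = 1/x_k²
      have hsq : g k ^ 2 = 1 / (1 / g k ^ 2) := by rw [one_div_one_div]
      have h4 : g k ^ 4 = 1 / (1 / g k ^ 2) ^ 2 := by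
        rw [one_div_pow, one_div_one_div]; ring
      show 1 / g k ^ 2 - (a + δ k + b / (1 / g k ^ 2) + Cr / (1 / g k ^ 2) ^ 2) ≤ 1 / g (k + 1) ^ 2
      rw [heq]
      have : β k (FlowStep.prefixOf g k) ≤ a + δ k + b / (1 / g k ^ 2) + Cr / (1 / g k ^ 2) ^ 2 := by
        calc β k (FlowStep.prefixOf g k) ≤ a + δ k + b * g k ^ 2 + Cr * g k ^ 4 := hβle
          _ = a + δ k + b / (1 / g k ^ 2) + Cr / (1 / g k ^ 2) ^ 2 := by
            rw [div_eq_mul_one_div b, div_eq_mul_one_div Cr, ← hsq, ← h4]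
      linarith)
  -- read off `InInterval γ K`
  intro k hk
  obtain ⟨hpos, hline⟩ := H K le_rfl hwin k hk
  refine ⟨hpos, le_of_inv_sq_le hpos hγpos ?_⟩
  have hmono : a * (k : ℝ) ≤ a * K := by
    have : (k : ℝ) ≤ K := by exact_mod_cast hk
    nlinarith
  show X ≤ 1 / g k ^ 2
  linarith

end

end Summit.QuantumFields.YangMills.Cruxes.UVSeamRec.FlowWindow
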